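import Literature.MeasureTheory.Group.PadicIntHaar
import Mathlib.NumberTheory.Padics.RingHoms
import Mathlib.LinearAlgebra.Matrix.GeneralLinearGroup.Card
import Mathlib.MeasureTheory.Constructions.Pi
import HarnessLib

/-!
# The volume of `GLₙ(ℤ_p)` inside `Mₙ(ℤ_p) = ℤ_p^{n²}`: `|GLₙ(𝔽_p)| / p^{n²} = ∏ᵢ (1 − p^{−i})`

Topic `Literature/MeasureTheory/Group`; continues `PadicIntHaar.lean` (the normalised Haar measure
on `ℤ_[p]`, `μ_p` of a residue class). Everything here is PROVED (no named facts).

With respect to the additive measure `dx = ∏ dxᵢⱼ` on `Mₙ(ℤ_p)` (total mass `1`), the compact open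
subgroup `GLₙ(ℤ_p) = {x : det x ∈ ℤ_pˣ}` is the union of the residue classes modulo `p` lying over
`GLₙ(𝔽_p)`, hence has volume `|GLₙ(𝔽_p)| · p^{−n²} = ∏_{i=1}^{n} (1 − p^{−i})`; for `n = 2` this is
`(1 − p⁻¹)(1 − p⁻²)`. Since `|det x|_p = 1` on `GLₙ(ℤ_p)`, this is also its volume for the Haar
measure `|ω| = dx/|det x|ⁿ` of `GLₙ(ℚ_p)` given by the standard gauge form, and dividing by
`vol(ℤ_pˣ) = 1 − p⁻¹` gives Bhargava–Shankar's "the volume of `PGL₂(ℤ_p)` with respect to the Haar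
measure obtained from the `N̄AN` decomposition of `PGL₂(ℚ_p)` is equal to `(1 − 1/p²)` for `p ≥ 3`"
(Ann. of Math. 181 (2015), proof of Prop. 5.12 of the arXiv v2 text = Prop. 3.9 / Cor. 3.8 of the
published version), the local constant in the `2`-Selmer sieve. Only the additive statement is
proved here:

* `padicInt_volume_setOf_toZMod_eq` — a residue class mod `p` in `ℤ_p` has measure `p⁻¹`;
  `padicInt_volume_setOf_matrix_toZMod_eq` — a residue class mod `p` in `Mₙ(ℤ_p)` has measure
  `p^{−n²}`.
* `isUnit_det_iff_det_toZMod_ne_zero` — `x ∈ GLₙ(ℤ_p)` iff `det(x mod p) ≠ 0`.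
* `padicInt_volume_setOf_isUnit_det` — **`vol(GLₙ(ℤ_p)) = |GLₙ(𝔽_p)| · p^{−n²}`**, with
  `|GLₙ(𝔽_p)| = ∏_{i<n} (pⁿ − pⁱ)` (Mathlib `Matrix.card_GL_field`);
  `padicInt_volume_setOf_isUnit_det_two` — `vol(GL₂(ℤ_p)) = (p²−1)(p²−p)/p⁴`, and in `ℝ`:
  `(1 − p⁻¹)(1 − p⁻²)` (`padicInt_volume_real_setOf_isUnit_det_two`).

## References

* A. Weil, *Adeles and algebraic groups*, Progress in Math. 23 (1982), Ch. II §2.2 and Thm 2.2.5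
  (volumes of `G(ℤ_p)` by counting points mod `p`). [folklore]
* M. Bhargava, A. Shankar, Ann. of Math. (2) 181 (2015) 191–242, proof of Prop. 5.12 (arXiv
  v2) = §3.3–3.4 of the published version. [cite: BhargavaShankarAnnals2015, Prop. 5.12 proof (Vol(PGL₂(ℤ_p)) = 1 − p⁻²; arXiv:1006.1002v2 numbering)]
-/

noncomputable section

open MeasureTheory MeasureTheory.Measure Set Metric
open scoped ENNReal

namespace Literature.MeasureTheory.Group

variable {p : ℕ} [Fact p.Prime]

/-! ## Residue classes mod `p` -/

/-- An element of `ℤ_p` reduces to `0` mod `p` iff it is a non-unit iff `‖x‖ < 1`. [folklore] -/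
theorem padicInt_toZMod_eq_zero_iff (x : ℤ_[p]) : PadicInt.toZMod x = 0 ↔ ‖x‖ < 1 := by
  rw [← RingHom.mem_ker, PadicInt.ker_toZMod, IsLocalRing.mem_maximalIdeal, PadicInt.mem_nonunits]

/-- `x ∈ ℤ_pˣ` iff `x mod p ≠ 0`. [folklore] -/
theorem padicInt_isUnit_iff_toZMod_ne_zero (x : ℤ_[p]) : IsUnit x ↔ PadicInt.toZMod x ≠ 0 := by
  rw [Ne, padicInt_toZMod_eq_zero_iff, PadicInt.isUnit_iff]
  constructor
  · intro h; rw [h]; exact lt_irrefl 1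
  · intro h; exact le_antisymm x.norm_le_one (not_lt.mp h)

/-- The residue class of `d` mod `p` is the closed ball of radius `p⁻¹` about the lift `d.val`.
[folklore] -/
theorem padicInt_setOf_toZMod_eq (d : ZMod p) :
    {a : ℤ_[p] | PadicInt.toZMod a = d} = closedBall ((d.val : ℕ) : ℤ_[p]) ((p : ℝ) ^ (-(1 : ℕ) : ℤ)) := by
  ext a
  have hlift : PadicInt.toZMod ((d.val : ℕ) : ℤ_[p]) = d := by
    rw [map_natCast, ZMod.natCast_zmod_val]
  rw [mem_setOf_eq, mem_closedBall, dist_eq_norm, show (-(1 : ℕ) : ℤ) = -1 by norm_num,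
    PadicInt.norm_le_pow_iff_norm_lt_pow_add_one, show (-1 : ℤ) + 1 = 0 by norm_num, zpow_zero,
    ← padicInt_toZMod_eq_zero_iff, map_sub, hlift, sub_eq_zero]

/-- **A residue class mod `p` in `ℤ_p` has measure `p⁻¹`.** [folklore] -/
theorem padicInt_volume_setOf_toZMod_eq (d : ZMod p) :
    volume {a : ℤ_[p] | PadicInt.toZMod a = d} = (p : ℝ≥0∞)⁻¹ := by
  rw [padicInt_setOf_toZMod_eq, padicInt_volume_closedBall, pow_one]

/-- Residue classes are measurable. [folklore] -/
theorem padicInt_measurableSet_setOf_toZMod_eq (d : ZMod p) :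
    MeasurableSet {a : ℤ_[p] | PadicInt.toZMod a = d} := by
  rw [padicInt_setOf_toZMod_eq]; exact measurableSet_closedBall

variable {n : ℕ}

/-- A residue class mod `p` in `Mₙ(ℤ_p) = ℤ_p^{n×n}` is a box of residue classes. [folklore] -/
theorem setOf_matrix_toZMod_eq (c : Fin n → Fin n → ZMod p) :
    {x : Fin n → Fin n → ℤ_[p] | (fun i j ↦ PadicInt.toZMod (x i j)) = c} =
      Set.pi univ fun i ↦ Set.pi univ fun j ↦ {a : ℤ_[p] | PadicInt.toZMod a = c i j} := by
  ext x
  simp only [mem_setOf_eq, mem_univ_pi, funext_iff]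

/-- Residue classes in `Mₙ(ℤ_p)` are measurable. [folklore] -/
theorem measurableSet_setOf_matrix_toZMod_eq (c : Fin n → Fin n → ZMod p) :
    MeasurableSet {x : Fin n → Fin n → ℤ_[p] | (fun i j ↦ PadicInt.toZMod (x i j)) = c} := by
  rw [setOf_matrix_toZMod_eq]
  exact MeasurableSet.univ_pi fun i ↦ MeasurableSet.univ_pi fun j ↦
    padicInt_measurableSet_setOf_toZMod_eq _

/-- **A residue class mod `p` in `Mₙ(ℤ_p)` has measure `p^{−n²}`.** [folklore] -/
theorem padicInt_volume_setOf_matrix_toZMod_eq (c : Fin n → Fin n → ZMod p) :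
    volume {x : Fin n → Fin n → ℤ_[p] | (fun i j ↦ PadicInt.toZMod (x i j)) = c} =
      ((p : ℝ≥0∞) ^ (n * n))⁻¹ := by
  rw [setOf_matrix_toZMod_eq, volume_pi, Measure.pi_pi]
  simp_rw [volume_pi, Measure.pi_pi, padicInt_volume_setOf_toZMod_eq, Finset.prod_const,
    Finset.card_univ, Fintype.card_fin, ← pow_mul, ENNReal.inv_pow]

/-! ## `GLₙ(ℤ_p)` as a union of residue classes -/

/-- **`x ∈ GLₙ(ℤ_p)` iff `det (x mod p) ≠ 0`.** [folklore] -/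
theorem isUnit_det_iff_det_toZMod_ne_zero (x : Fin n → Fin n → ℤ_[p]) :
    IsUnit (Matrix.of x).det ↔ (Matrix.of fun i j ↦ PadicInt.toZMod (x i j)).det ≠ 0 := by
  rw [padicInt_isUnit_iff_toZMod_ne_zero, RingHom.map_det]
  rfl

/-- `|{c ∈ Mₙ(𝔽_p) : det c ≠ 0}| = |GLₙ(𝔽_p)|` (the units of the matrix ring are the matrices of
nonzero determinant). [folklore] -/
theorem card_setOf_det_ne_zero :
    Nat.card {c : Fin n → Fin n → ZMod p // (Matrix.of c).det ≠ 0} = Nat.card (GL (Fin n) (ZMod p)) := by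
  -- `Mˣ ≃ {x : M // IsUnit x}` for the monoid of matrices
  let e : GL (Fin n) (ZMod p) ≃ {x : Matrix (Fin n) (Fin n) (ZMod p) // IsUnit x} :=
    { toFun := fun u ↦ ⟨u, u.isUnit⟩
      invFun := fun x ↦ x.2.unit
      left_inv := fun u ↦ Units.ext (by simp)
      right_inv := fun x ↦ Subtype.ext (by simp) }
  refine Nat.card_congr ?_
  refine (Equiv.subtypeEquiv (Matrix.of : (Fin n → Fin n → ZMod p) ≃ Matrix (Fin n) (Fin n) (ZMod p))
    (fun c ↦ ?_)).trans e.symm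
  rw [Matrix.isUnit_iff_isUnit_det, isUnit_iff_ne_zero]

/-- **`vol(GLₙ(ℤ_p)) = |GLₙ(𝔽_p)| · p^{−n²}`** for the additive probability measure on `Mₙ(ℤ_p)`.
[folklore] -/
theorem padicInt_volume_setOf_isUnit_det :
    volume {x : Fin n → Fin n → ℤ_[p] | IsUnit (Matrix.of x).det} =
      (Nat.card (GL (Fin n) (ZMod p)) : ℝ≥0∞) * ((p : ℝ≥0∞) ^ (n * n))⁻¹ := by
  classical
  set red : (Fin n → Fin n → ℤ_[p]) → (Fin n → Fin n → ZMod p) := fun x i j ↦ PadicInt.toZMod (x i j)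
    with hred
  set G : Finset (Fin n → Fin n → ZMod p) := Finset.univ.filter fun c ↦ (Matrix.of c).det ≠ 0 with hG
  have hS : {x : Fin n → Fin n → ℤ_[p] | IsUnit (Matrix.of x).det} = ⋃ c ∈ G, {x | red x = c} := by
    ext x
    simp only [mem_setOf_eq, mem_iUnion, hG, Finset.mem_filter, Finset.mem_univ, true_and,
      exists_prop, exists_eq_right', isUnit_det_iff_det_toZMod_ne_zero]
    rfl
  rw [hS, measure_biUnion_finset]
  · simp_rw [hred, padicInt_volume_setOf_matrix_toZMod_eq, Finset.sum_const, nsmul_eq_mul]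
    congr 1
    rw [← card_setOf_det_ne_zero, Nat.card_eq_fintype_card, Fintype.card_subtype, hG]
  · intro c _ c' _ hcc'
    exact disjoint_left.mpr fun x (hx : red x = c) (hx' : red x = c') ↦ hcc' (hx.symm.trans hx')
  · intro c _
    exact measurableSet_setOf_matrix_toZMod_eq c

/-- `|GLₙ(𝔽_p)| = ∏_{i<n} (pⁿ − pⁱ)`. [folklore] -/
theorem card_GL_zmod : Nat.card (GL (Fin n) (ZMod p)) = ∏ i : Fin n, (p ^ n - p ^ (i : ℕ)) := by
  rw [Matrix.card_GL_field, ZMod.card]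

/-- **`vol(GL₂(ℤ_p)) = (p² − 1)(p² − p)/p⁴`.** [folklore] -/
theorem padicInt_volume_setOf_isUnit_det_two :
    volume {x : Fin 2 → Fin 2 → ℤ_[p] | IsUnit (Matrix.of x).det} =
      ((p ^ 2 - 1) * (p ^ 2 - p) : ℕ) * ((p : ℝ≥0∞) ^ 4)⁻¹ := by
  rw [padicInt_volume_setOf_isUnit_det, card_GL_zmod]
  simp [Fin.prod_univ_two]

/-- **`vol(GL₂(ℤ_p)) = (1 − p⁻¹)(1 − p⁻²)`** (real form). Dividing by `vol(ℤ_pˣ) = 1 − p⁻¹` this is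
Bhargava–Shankar's `Vol(PGL₂(ℤ_p)) = 1 − p⁻²`. [folklore] -/
theorem padicInt_volume_real_setOf_isUnit_det_two :
    (volume {x : Fin 2 → Fin 2 → ℤ_[p] | IsUnit (Matrix.of x).det}).toReal =
      (1 - (p : ℝ)⁻¹) * (1 - ((p : ℝ) ^ 2)⁻¹) := by
  have hp : (0 : ℝ) < p := by exact_mod_cast (Fact.out : p.Prime).pos
  have hp1 : 1 ≤ p := (Fact.out : p.Prime).one_lt.le
  rw [padicInt_volume_setOf_isUnit_det_two, ENNReal.toReal_mul, ENNReal.toReal_natCast,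
    ENNReal.toReal_inv, ENNReal.toReal_pow, ENNReal.toReal_natCast]
  have h1 : p ^ 2 - 1 + 1 = p ^ 2 := Nat.sub_add_cancel (one_le_pow₀ hp1)
  have h2 : p ^ 2 - p + p = p ^ 2 := Nat.sub_add_cancel (by nlinarith)
  have e1 : ((p ^ 2 - 1 : ℕ) : ℝ) = (p : ℝ) ^ 2 - 1 := by
    have := congrArg (fun m : ℕ ↦ (m : ℝ)) h1; push_cast at this; linarith
  have e2 : ((p ^ 2 - p : ℕ) : ℝ) = (p : ℝ) ^ 2 - p := by
    have := congrArg (fun m : ℕ ↦ (m : ℝ)) h2; push_cast at this; linarith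
  push_cast
  rw [e1, e2]
  field_simp

end Literature.MeasureTheory.Group

end
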